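import Mathlib
import Literature.NumberTheory.EllipticCurves.OrdinaryPrimes
import Literature.NumberTheory.Sieve.PrimeDivisorsOfPolynomials
import HarnessLib

/-!
# Existence of a good ordinary prime `p ≥ 5` — discharged fact

Proof of the named fact `WeierstrassCurve.exists_good_ordinary_prime` stated in
`Literature.NumberTheory.EllipticCurves.OrdinaryPrimes` (kept in a sibling file so that the
statement file stays a named-facts file).

The cited sources (Serre 1981, §8: supersingular primes of a non-CM curve have density `0`, via
the Chebotarev density theorem; Deuring 1941 for CM curves) prove much more than the vendored
statement and are far beyond Mathlib. The vendored statement itself — *some* prime `p ≥ 5` of good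
reduction with `p ∤ a_p` — has the following **elementary proof**, formalised here:

1. Let `M/ℤ` be the integral model of the globally minimal equation `W`, `Δ_M ≠ 0`, and let
   `c = 4X³ + b₂X² + 2b₄X + b₆` be its 2-torsion cubic (`disc c = 16 Δ_M`).  By the "poor man's
   Chebotarev theorem" (`Literature.NumberTheory.Sieve.exists_prime_gt_map_int_splits`, an elementary consequence of
   Schur's 1912 theorem on prime divisors of polynomials, discharged in
   `Literature.NumberTheory.Sieve.PrimeDivisorsOfPolynomials`) there is a prime
   `p > max(4, |Δ_M|)` modulo which `c · (X² + 1)` is a product of linear factors.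
2. Then `-1` is a square mod `p`, so `p ≡ 1 (mod 4)`; and `c` has three distinct roots `xᵢ ∈ 𝔽_p`
   (`disc c ≢ 0`), giving three points `Pᵢ = (xᵢ, -(a₁xᵢ + a₃)/2)` of order `2` on the reduction
   `Ẽ/𝔽_p` (an elliptic curve since `p ∤ Δ_M`).  Hence `{0, P₁, P₂, P₁ + P₂}` is a subgroup of
   order `4` and `4 ∣ N_p = #Ẽ(𝔽_p)` (Lagrange).
3. Every `x ∈ 𝔽_p` carries at most two points, so `1 ≤ N_p ≤ 2p + 1`; therefore
   `p ∣ a_p = p + 1 - N_p` forces `N_p ∈ {1, p + 1, 2p + 1} ≡ {1, 2, 3} (mod 4)`, contradicting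
   `4 ∣ N_p`.  So `p ∤ a_p` (no appeal to the Hasse bound is needed).
4. Good reduction at `p`: `M ⊗ ℤ_p` is an integral model of `W/ℚ_p` whose discriminant is a
   `p`-adic unit, so the `ℤ_p`-minimal model chosen by Mathlib (`WeierstrassCurve.minimal`) has unit
   discriminant as well (`IsMinimal` is maximality of the valuation of `Δ` among integral models).

## References

* J.-P. Serre, *Quelques applications du théorème de densité de Chebotarev*, Publ. Math. IHÉS 54
  (1981), 123–201, §8 — the cited (much stronger) density statement.
* I. Schur, Sitzungsber. Berliner Math. Ges. 11 (1912), 40–50 — prime divisors of polynomials.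
* J. H. Silverman, *The Arithmetic of Elliptic Curves*, GTM 106, 2nd ed. (2009), III.2.3 and
  Exercise 3.7 (2-torsion points are `(x, -(a₁x+a₃)/2)` with `x` a root of `4x³+b₂x²+2b₄x+b₆`),
  VII.1 (minimal equations: unit discriminant ⇒ minimal, Remark VII.1.1).
-/

noncomputable section

open scoped Classical
open Polynomial

namespace WeierstrassCurve

/-! ### An abelian group with two distinct non-zero `2`-torsion elements has order divisible by `4` -/

/-- If an abelian group contains two distinct non-zero elements `P, Q` with `2P = 2Q = 0`, then
`{0, P, Q, P + Q}` is a subgroup of order `4`, so `4 ∣ #G` (Lagrange; for infinite `G`,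
`Nat.card G = 0`). [folklore] -/
theorem four_dvd_natCard_of_two_torsion {G : Type*} [AddCommGroup G] {P Q : G}
    (hP : P ≠ 0) (hQ : Q ≠ 0) (hPQ : P ≠ Q) (hP2 : P + P = 0) (hQ2 : Q + Q = 0) :
    4 ∣ Nat.card G := by
  have h1 : P + (P + Q) = Q := by rw [← add_assoc, hP2, zero_add]
  have h2 : Q + (P + Q) = P := by rw [add_comm P Q, ← add_assoc, hQ2, zero_add]
  have h3 : P + Q + P = Q := by rw [add_comm, h1]
  have h4 : P + Q + Q = P := by rw [add_assoc, hQ2, add_zero]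
  have h5 : P + Q + (P + Q) = 0 := by rw [add_add_add_comm, hP2, hQ2, add_zero]
  have h6 : Q + P = P + Q := add_comm Q P
  have hnegP : -P = P := by rw [neg_eq_iff_add_eq_zero, hP2]
  have hnegQ : -Q = Q := by rw [neg_eq_iff_add_eq_zero, hQ2]
  have hPQ0 : P + Q ≠ 0 := fun h => hPQ (by rw [← hnegQ, eq_neg_iff_add_eq_zero, h])
  let H : AddSubgroup G :=
    { carrier := {0, P, Q, P + Q}
      zero_mem' := by simp
      add_mem' := by
        rintro a b ha hb
        simp only [Set.mem_insert_iff, Set.mem_singleton_iff] at ha hb ⊢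
        rcases ha with rfl | rfl | rfl | rfl <;> rcases hb with rfl | rfl | rfl | rfl <;>
          simp only [zero_add, add_zero, hP2, hQ2, h1, h2, h3, h4, h5, h6, true_or, or_true]
      neg_mem' := by
        rintro a ha
        simp only [Set.mem_insert_iff, Set.mem_singleton_iff] at ha ⊢
        rcases ha with rfl | rfl | rfl | rfl
        · simp
        · simp [hnegP]
        · simp [hnegQ]
        · rw [neg_add, hnegP, hnegQ]; simp }
  have hA : (0 : G) ∉ ({P, Q, P + Q} : Set G) := by
    simp only [Set.mem_insert_iff, Set.mem_singleton_iff, not_or]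
    exact ⟨fun h => hP h.symm, fun h => hQ h.symm, fun h => hPQ0 h.symm⟩
  have hB : P ∉ ({Q, P + Q} : Set G) := by
    simp only [Set.mem_insert_iff, Set.mem_singleton_iff, not_or]
    exact ⟨hPQ, fun h => hQ (by simpa using h)⟩
  have hC : Q ≠ P + Q := fun h => hP (by simpa using h)
  have hcard : Nat.card H = 4 := by
    change Nat.card (({0, P, Q, P + Q} : Set G) : Type _) = 4
    rw [Nat.card_coe_set_eq, Set.ncard_insert_of_notMem hA, Set.ncard_insert_of_notMem hB,
      Set.ncard_pair hC]
  exact hcard ▸ H.card_addSubgroup_dvd_card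

/-! ### Elliptic curves over a field: 2-torsion points and a crude point count -/

section Field

variable {F : Type*} [Field F] [DecidableEq F] (E : WeierstrassCurve F)

omit [DecidableEq F] in
/-- A root `x₀` of the 2-torsion cubic `4x³ + b₂x² + 2b₄x + b₆` gives the point
`(x₀, -(a₁x₀ + a₃)/2)` on the curve (char `≠ 2`): with `2y₀ = -(a₁x₀ + a₃)` the Weierstrass
equation at `(x₀, y₀)` is `-(4·cubic(x₀) + (a₁x₀+a₃)²)/4 = -c(x₀)/4 = 0`
(Silverman, *AEC* III.2.3 / Ex. 3.7). [folklore] -/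
theorem equation_of_twoTorsionPolynomial_root (h2 : (2 : F) ≠ 0) {x₀ : F}
    (hx : 4 * x₀ ^ 3 + E.b₂ * x₀ ^ 2 + 2 * E.b₄ * x₀ + E.b₆ = 0) :
    E.toAffine.Equation x₀ (-(E.a₁ * x₀ + E.a₃) / 2) := by
  set y₀ : F := -(E.a₁ * x₀ + E.a₃) / 2 with hy₀
  have hy : 2 * y₀ + (E.a₁ * x₀ + E.a₃) = 0 := by
    rw [hy₀, mul_div_cancel₀ _ h2, neg_add_cancel]
  rw [Affine.equation_iff]
  simp only [b₂, b₄, b₆] at hx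
  have h4 : (4 : F) ≠ 0 := by
    have : (4 : F) = 2 * 2 := by norm_num
    rw [this]; exact mul_ne_zero h2 h2
  have key : (4 : F) * (y₀ ^ 2 + E.a₁ * x₀ * y₀ + E.a₃ * y₀
      - (x₀ ^ 3 + E.a₂ * x₀ ^ 2 + E.a₄ * x₀ + E.a₆)) = 0 := by
    linear_combination (2 * y₀ + (E.a₁ * x₀ + E.a₃)) * hy - hx
  have := (mul_eq_zero.mp key).resolve_left h4
  exact sub_eq_zero.mp this

omit [DecidableEq F] in
/-- The point of order `2` attached to a root of the 2-torsion cubic is its own negative: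
`negY x₀ y₀ = -y₀ - a₁x₀ - a₃ = y₀`. [folklore] -/
theorem negY_twoTorsion (h2 : (2 : F) ≠ 0) (x₀ : F) :
    E.toAffine.negY x₀ (-(E.a₁ * x₀ + E.a₃) / 2) = -(E.a₁ * x₀ + E.a₃) / 2 := by
  rw [Affine.negY]
  field_simp
  ring

/-- If the 2-torsion cubic of an elliptic curve `E` over a field of characteristic `≠ 2` splits
into linear factors, then `E(F) ⊇ ℤ/2 × ℤ/2` and hence `4 ∣ #E(F)` (Silverman, *AEC* III.2.3,
Ex. 3.7; the three roots are distinct because `disc = 16Δ ≠ 0`). [folklore] -/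
theorem four_dvd_natCard_point_of_splits [E.IsElliptic] (h2 : (2 : F) ≠ 0)
    (hs : E.twoTorsionPolynomial.toPoly.Splits) : 4 ∣ Nat.card E.toAffine.Point := by
  have h4 : (4 : F) ≠ 0 := by
    have : (4 : F) = 2 * 2 := by norm_num
    rw [this]; exact mul_ne_zero h2 h2
  have ha : E.twoTorsionPolynomial.a ≠ 0 := h4
  have hs' : (E.twoTorsionPolynomial.toPoly.map (RingHom.id F)).Splits := by rwa [Polynomial.map_id]
  obtain ⟨x, y, z, h3⟩ := (Cubic.splits_iff_roots_eq_three ha).mp hs'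
  have hdisc : E.twoTorsionPolynomial.discr ≠ 0 :=
    E.twoTorsionPolynomial_discr_ne_zero_of_isElliptic (isUnit_iff_ne_zero.mpr h2)
  obtain ⟨hxy, -, -⟩ := (Cubic.discr_ne_zero_iff_roots_ne ha h3).mp hdisc
  have hmapid : Cubic.map (RingHom.id F) E.twoTorsionPolynomial = E.twoTorsionPolynomial := by
    simp [Cubic.map]
  rw [hmapid] at h3
  have h0 : E.twoTorsionPolynomial.toPoly ≠ 0 := Cubic.ne_zero_of_a_ne_zero ha
  have hroot : ∀ t ∈ E.twoTorsionPolynomial.roots,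
      4 * t ^ 3 + E.b₂ * t ^ 2 + 2 * E.b₄ * t + E.b₆ = 0 := fun t ht => by
    simpa [twoTorsionPolynomial] using (Cubic.mem_roots_iff h0 t).mp ht
  have hxr : x ∈ E.twoTorsionPolynomial.roots := by rw [h3]; simp
  have hyr : y ∈ E.twoTorsionPolynomial.roots := by rw [h3]; simp
  -- the two points of order two
  set Px : E.toAffine.Point := .some x _ ((Affine.equation_iff_nonsingular).mp
    (E.equation_of_twoTorsionPolynomial_root h2 (hroot x hxr))) with hPx
  set Py : E.toAffine.Point := .some y _ ((Affine.equation_iff_nonsingular).mp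
    (E.equation_of_twoTorsionPolynomial_root h2 (hroot y hyr))) with hPy
  have hnegx : -Px = Px := by
    rw [hPx, Affine.Point.neg_some]
    congr 1
    exact E.negY_twoTorsion h2 x
  have hnegy : -Py = Py := by
    rw [hPy, Affine.Point.neg_some]
    congr 1
    exact E.negY_twoTorsion h2 y
  refine four_dvd_natCard_of_two_torsion (P := Px) (Q := Py) (Affine.Point.some_ne_zero _)
    (Affine.Point.some_ne_zero _) ?_ ?_ ?_
  · intro h
    rw [hPx, hPy] at h
    injection h with hx' _
    exact hxy hx'
  · rw [← neg_eq_iff_add_eq_zero, hnegx]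
  · rw [← neg_eq_iff_add_eq_zero, hnegy]

/-- Crude point count: over a finite field every `x` carries at most two points, so
`#E(F) ≤ 2·#F + 1` (sharper than the `#F² + 1` of `WeierstrassCurve.natCard_point_le` in
`AnalyticRankProofs`, and needed here). [folklore] -/
theorem natCard_point_le_two_mul_card [Fintype F] :
    Nat.card E.toAffine.Point ≤ 2 * Fintype.card F + 1 := by
  -- the finite set of affine solutions
  let S : Finset (F × F) := Finset.univ.filter fun xy => E.toAffine.Equation xy.1 xy.2
  -- injection `E(F) ↪ Option S`
  let g : E.toAffine.Point → Option S := fun P => match P with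
    | .zero => none
    | .some x y h => some ⟨(x, y), by simp [S, h.1]⟩
  have hg : Function.Injective g := by
    rintro (_ | ⟨x, y, h⟩) (_ | ⟨x', y', h'⟩) hPQ
    · rfl
    · simp [g] at hPQ
    · simp [g] at hPQ
    · simp only [g, Option.some.injEq, Subtype.mk.injEq, Prod.mk.injEq] at hPQ
      obtain ⟨rfl, rfl⟩ := hPQ
      rfl
  have hle := Nat.card_le_card_of_injective g hg
  rw [Finite.card_option, Nat.card_eq_fintype_card (α := S), Fintype.card_coe] at hle
  -- `#S ≤ 2 #F`: the fibre over `x` injects into the roots of a monic quadratic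
  have hS : S.card ≤ 2 * Fintype.card F := by
    rw [Finset.card_eq_sum_card_fiberwise (f := Prod.fst) (t := Finset.univ)
      (fun _ _ => Finset.mem_coe.mpr (Finset.mem_univ _))]
    have := Finset.sum_le_card_nsmul (Finset.univ : Finset F)
      (fun x => (S.filter fun a => a.1 = x).card) 2 ?_
    · simpa [mul_comm] using this
    intro x _
    -- the quadratic `Y² + (a₁ x + a₃) Y - (x³ + a₂ x² + a₄ x + a₆)` as a `Cubic` with `a = 0`
    let q : Cubic F := ⟨0, 1, E.a₁ * x + E.a₃, -(x ^ 3 + E.a₂ * x ^ 2 + E.a₄ * x + E.a₆)⟩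
    have hq0 : q.toPoly ≠ 0 := Cubic.ne_zero_of_b_ne_zero one_ne_zero
    have hqdeg : q.toPoly.natDegree = 2 := Cubic.natDegree_of_b_ne_zero rfl one_ne_zero
    calc (S.filter fun a => a.1 = x).card
        ≤ q.roots.toFinset.card := by
          refine Finset.card_le_card_of_injOn Prod.snd (fun a ha => ?_) ?_
          · simp only [Finset.coe_filter, Set.mem_setOf_eq, S, Finset.mem_filter,
              Finset.mem_univ, true_and] at ha
            obtain ⟨heq, rfl⟩ := ha
            rw [Finset.mem_coe, Multiset.mem_toFinset, Cubic.mem_roots_iff hq0]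
            rw [Affine.equation_iff] at heq
            linear_combination heq
          · rintro ⟨a1, a2⟩ ha ⟨b1, b2⟩ hb h
            simp only [Finset.coe_filter, S, Finset.mem_filter, Finset.mem_univ, true_and,
              Set.mem_setOf_eq] at ha hb h
            rw [Prod.mk.injEq]
            exact ⟨ha.2.trans hb.2.symm, h⟩
      _ ≤ q.roots.card := Multiset.toFinset_card_le _
      _ ≤ q.toPoly.natDegree := Polynomial.card_roots' _
      _ = 2 := hqdeg
  omega

end Field

/-! ### Reduction of the integral model modulo `p` -/

/-- The 2-torsion cubic commutes with base change. [folklore] -/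
theorem map_twoTorsionPolynomial {R S : Type*} [CommRing R] [CommRing S] (W : WeierstrassCurve R)
    (f : R →+* S) : (W.map f).twoTorsionPolynomial = Cubic.map f W.twoTorsionPolynomial := by
  simp [twoTorsionPolynomial, Cubic.map, map_b₂, map_b₄, map_b₆, map_ofNat]

/-- Good reduction away from the minimal discriminant: if `p ∤ Δ_min(W)` then the `ℤ_p`-minimal
model of `W/ℚ_p` has unit discriminant, i.e. `W` has good reduction at `p`
(Silverman, *AEC* VII.1, Remark 1.1: an integral equation with `v(Δ) = 0` is minimal, and all
minimal equations have the same `v(Δ)`). [folklore] -/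
theorem hasGoodReductionAtPrime_of_not_dvd (W : WeierstrassCurve ℚ) [W.IsGloballyMinimal] (p : ℕ)
    [Fact p.Prime] (hp : ¬ (p : ℤ) ∣ minimalDiscriminantInt W) : W.HasGoodReductionAtPrime p := by
  unfold HasGoodReductionAtPrime
  -- `M ⊗ ℤ_p` is an integral model of `W / ℚ_p`
  set Mp : WeierstrassCurve ℤ_[p] := (integralModelInt W).map (Int.castRingHom ℤ_[p]) with hMp
  have hW : W.baseChange ℚ_[p] = Mp.baseChange ℚ_[p] := by
    conv_lhs => rw [← map_integralModelInt W]
    rw [baseChange, baseChange, map_map, hMp, map_map]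
    congr 1
  haveI hint : (W.baseChange ℚ_[p]).IsIntegral ℤ_[p] := ⟨⟨Mp, hW⟩⟩
  have hΔ : IsDedekindDomain.HeightOneSpectrum.valuation ℚ_[p]
      (IsDiscreteValuationRing.maximalIdeal ℤ_[p]) (W.baseChange ℚ_[p]).Δ = 1 := by
    rw [hW, baseChange, map_Δ,
      IsDedekindDomain.HeightOneSpectrum.valuation_eq_one_iff_notMem]
    change Mp.Δ ∉ IsLocalRing.maximalIdeal ℤ_[p]
    rw [hMp, map_Δ, IsLocalRing.mem_maximalIdeal, PadicInt.mem_nonunits, eq_intCast,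
      PadicInt.norm_int_lt_one_iff_dvd]
    exact hp
  -- the chosen minimal model `C • W_p` has valuation of `Δ` at least that of `W_p`, i.e. `1`
  set Wp := W.baseChange ℚ_[p] with hWp
  have hmax := (inferInstance : (Wp.minimal ℤ_[p]).IsMinimal ℤ_[p]).val_Δ_maximal
  set C : VariableChange ℚ_[p] := (Wp.exists_isMinimal ℤ_[p]).choose with hC
  have hmin : Wp.minimal ℤ_[p] = C • Wp := rfl
  have hj : (C⁻¹ • Wp.minimal ℤ_[p]) = Wp := by rw [hmin, inv_smul_smul]
  have hPj : (C⁻¹ • Wp.minimal ℤ_[p]).IsIntegral ℤ_[p] := by rw [hj]; exact hint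
  have hle : valuation_Δ_aux ℤ_[p] ((1 : VariableChange ℚ_[p]) • Wp.minimal ℤ_[p]) ≤
      valuation_Δ_aux ℤ_[p] (C⁻¹ • Wp.minimal ℤ_[p]) := by
    rw [hj, ← Subtype.coe_le_coe, valuation_Δ_aux_eq_of_isIntegral ℤ_[p] Wp, hΔ]
    exact (valuation_Δ_aux ℤ_[p] _).2
  have hge := hmax.2 hPj hle
  simp only [] at hge
  rw [hj, ← Subtype.coe_le_coe, valuation_Δ_aux_eq_of_isIntegral ℤ_[p] Wp, hΔ, one_smul,
    valuation_Δ_aux_eq_of_isIntegral] at hge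
  obtain ⟨r, hr⟩ := Δ_integral_of_isIntegral ℤ_[p] (Wp.minimal ℤ_[p])
  refine ⟨le_antisymm ?_ hge⟩
  rw [← hr]
  exact IsDedekindDomain.HeightOneSpectrum.valuation_le_one _ _

/-! ### The main theorem -/

/-- **Discharge of `WeierstrassCurve.exists_good_ordinary_prime`.** Every elliptic curve over `ℚ`
(given by a globally minimal Weierstrass equation) has a prime `p ≥ 5` of good reduction with
`p ∤ a_p`, i.e. a good ordinary prime. Elementary proof via primes `p ≡ 1 (mod 4)` modulo which
the 2-torsion cubic splits (see the module docstring); the cited source proves the much stronger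
density statement. [cite: Serre1981, §8 (with Deuring 1941 for CM)] -/
theorem exists_good_ordinary_prime_holds : exists_good_ordinary_prime := by
  intro W _ _
  set M : WeierstrassCurve ℤ := integralModelInt W with hM
  have hΔ0 : M.Δ ≠ 0 := minimalDiscriminantInt_ne_zero W
  -- the polynomial `c · (X² + 1)`
  set c : ℤ[X] := M.twoTorsionPolynomial.toPoly with hc
  have hc0 : c ≠ 0 := Cubic.ne_zero_of_a_ne_zero (by norm_num [twoTorsionPolynomial])
  have hF0 : c * (X ^ 2 + 1) ≠ 0 :=
    mul_ne_zero hc0 (Polynomial.monic_X_pow_add_C 1 two_ne_zero).ne_zero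
  obtain ⟨p, hp, hNp, hsplit⟩ :=
    Literature.NumberTheory.Sieve.exists_prime_gt_map_int_splits_holds (c * (X ^ 2 + 1)) hF0 (4 + M.Δ.natAbs)
  haveI := Fact.mk hp
  refine ⟨p, ⟨hp⟩, by omega, ?_, ?_⟩
  · -- good reduction: `p ∤ Δ_M` since `p > |Δ_M|`
    refine hasGoodReductionAtPrime_of_not_dvd W p fun h => ?_
    have := Nat.le_of_dvd (Int.natAbs_pos.mpr hΔ0) (Int.ofNat_dvd_left.mp h)
    omega
  · -- ordinarity
    have hp2 : (2 : ZMod p) ≠ 0 := by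
      intro h
      have : ((2 : ℕ) : ZMod p) = 0 := by exact_mod_cast h
      rw [ZMod.natCast_eq_zero_iff] at this
      have := Nat.le_of_dvd two_pos this
      omega
    have hpΔ : ((M.Δ : ℤ) : ZMod p) ≠ 0 := by
      intro h
      rw [ZMod.intCast_zmod_eq_zero_iff_dvd] at h
      have := Nat.le_of_dvd (Int.natAbs_pos.mpr hΔ0) (Int.ofNat_dvd_left.mp h)
      omega
    -- the two factors split modulo `p`
    rw [Polynomial.map_mul] at hsplit
    have hX : ((X ^ 2 + 1 : ℤ[X]).map (Int.castRingHom (ZMod p))) = X ^ 2 + 1 := by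
      simp
    have hcp0 : c.map (Int.castRingHom (ZMod p)) ≠ 0 := by
      intro h
      have := congrArg (fun q => q.coeff 3) h
      simp only [hc, coeff_map, Cubic.coeff_eq_a, twoTorsionPolynomial, coeff_zero,
        eq_intCast] at this
      apply hp2
      have h4 : ((4 : ℤ) : ZMod p) = 2 * 2 := by push_cast; norm_num
      rw [h4] at this
      exact (mul_eq_zero.mp this).elim id id
    have hX0 : ((X ^ 2 + 1 : ℤ[X]).map (Int.castRingHom (ZMod p))) ≠ 0 := by
      rw [hX]; exact (Polynomial.monic_X_pow_add_C 1 two_ne_zero).ne_zero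
    have hne : c.map (Int.castRingHom (ZMod p)) *
        (X ^ 2 + 1 : ℤ[X]).map (Int.castRingHom (ZMod p)) ≠ 0 := mul_ne_zero hcp0 hX0
    have hcs : (c.map (Int.castRingHom (ZMod p))).Splits :=
      Splits.of_dvd hsplit hne (dvd_mul_right _ _)
    have hXs : ((X ^ 2 + 1 : ℤ[X]).map (Int.castRingHom (ZMod p))).Splits :=
      Splits.of_dvd hsplit hne (dvd_mul_left _ _)
    -- `p ≡ 1 (mod 4)`
    have hp4 : p % 4 = 1 := by
      rw [hX] at hXs
      obtain ⟨i, hi⟩ := hXs.exists_eval_eq_zero (by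
        rw [← C_1, Polynomial.degree_X_pow_add_C two_pos]; decide)
      simp only [eval_add, eval_pow, eval_X, eval_one] at hi
      have h3 := ZMod.mod_four_ne_three_of_sq_eq_neg_one (eq_neg_of_add_eq_zero_left hi)
      have hodd := hp.eq_one_or_self_of_dvd 2
      omega
    -- the reduced curve is elliptic and its 2-torsion cubic splits
    set E : WeierstrassCurve (ZMod p) := M.map (Int.castRingHom (ZMod p)) with hE
    haveI : E.IsElliptic := by
      rw [isElliptic_iff, hE, map_Δ, isUnit_iff_ne_zero, eq_intCast]
      exact hpΔ
    have hEs : E.twoTorsionPolynomial.toPoly.Splits := by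
      rw [hE, map_twoTorsionPolynomial, Cubic.map_toPoly, ← hc]
      exact hcs
    have h4N : 4 ∣ Nat.card E.toAffine.Point := four_dvd_natCard_point_of_splits E hp2 hEs
    have hNle : Nat.card E.toAffine.Point ≤ 2 * p + 1 := by
      simpa [ZMod.card] using natCard_point_le_two_mul_card E
    have hNpos : 0 < reductionPointCount W p := reductionPointCount_pos W p
    have hN : reductionPointCount W p = Nat.card E.toAffine.Point := rfl
    rw [frobeniusTrace, hN]
    set N := Nat.card E.toAffine.Point with hNdef
    rw [hN] at hNpos
    rintro ⟨k, hk⟩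
    -- `N = p (1 - k) + 1` with `0 ≤ 1 - k ≤ 2`
    have hp0 : (0 : ℤ) < p := by exact_mod_cast hp.pos
    have hj0 : 0 ≤ 1 - k := by nlinarith
    have hj2 : 1 - k ≤ 2 := by nlinarith
    have hNk : (N : ℤ) = p * (1 - k) + 1 := by linarith
    obtain ⟨j, hj⟩ : ∃ j : ℤ, j = 1 - k := ⟨_, rfl⟩
    rw [← hj] at hj0 hj2 hNk
    interval_cases j <;> omega

end WeierstrassCurve

end
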